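import Summits.QuantumFields.YangMills.Theorems.UnitScaleTiltCoverSitesBlocks
import Literature.MathematicalPhysics.QuantumFieldTheory.Balaban1983to89.T3Thm1Carrier
import HarnessLib

/-!
# Route `UnitScaleTilt`, crux K1 child «MinimiserStabilityRegPr» (stmt-QuantumFields-19200), stub `stub_halvingStep` (H), residual «H-SMALL», route of record
# (R-b″) «COVER LIFT» (★★OWNER RULING №28) — **LIFT PACKAGE, FILE 1: the stub's letters `Reg7` ∕ `InU` ∕ `InB` LIFT to the `L^{jc}`-fold cover `F.cover jc`
# AND DESCEND; the action scales by `(L^{jc})³`; minimality lifts among deck-invariant competitors**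

Cell `ym3-torus` (HUMAN RULING D-0037: YM₃ on T³ is ladder rung R3, not the Clay problem), width seat `ym-ust-20520-w3` gen 5 (RULING №28 (2) hand).
`--supports stmt-QuantumFields-19200 --as helper`; def-free (the lift of `U` is written `U ∘ projBond P jc j` — `GaugeField P j G` is `PBond P j → G`), 0 sorry,
standard axioms.  Nothing here claims the stub, the crux, d = 4 or the mass gap.

WHY.  At a member `(F, n, K)` WITHOUT ROOM (the top cube of the halving chart wraps the torus) the with-room door cannot be applied; RULING №28 lifts the
datum to the cover member `F.cover jc = ⟨L, m + jc⟩` (✓`CoverSites` §7), which has room.  Every hypothesis of the stub is LOCAL or an averaging constraint, so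
it lifts along the covering map `proj` of ✓`CoverSites`, and the conclusion `InU` is local, so it descends.  THIS FILE is that bookkeeping at the level of GAUGE
FIELDS (the (α) bricks α1–α8 are linear∕combinatorial): transports along words, plaquette holonomies, the covariant divergence, the Wilson action, the NONLINEAR
(0.4) average `BlockAveraging.avgFun ℰ` and its iterate, the descent `descendTo`, the fibre, `RegPr`, `regFibrePr` all intertwine with `· ∘ projBond`.  What does
NOT lift is the carrier's `IsCritical` (minimality over the regular fibre, `T3Thm1Carrier` reading R2): the cover's regular fibre has non-deck-invariant competitors;
§5 records the part that does (minimality among LIFTED competitors); the first-order transfer is FILE 2 (`…CoverLiftFirstVariation`).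

WHAT IS PROVED (`P : Params`, `jc : ℕ`, any `GaugeGroup`∕`Group` `G` unless stated; standing range `j + 1 ≤ P.m + P.K` where blocks∕centres enter):
§1 `holT_comp_projBond`, `holAt_walk_comp_projBond`, `proj_walkEnd`, ★`plaqHol_comp_projBond`, `plaqSmall_comp_projBond_iff`, `plaqFT_comp_projBond`, `covDerivT_comp_proj`,
★`covDivT_comp_proj`; §2 `card_fibre_plaq`, ★★`wilsonAction_comp_projBond`; §3 `proj_lineSite`, `pathProd_comp_projBond`, `axialAvg_comp_projBond`, `loopHol_comp_projBond`,
`small_comp_projBond_iff`, `corr_comp_projBond`, ★★`avgFun_comp_projBond`, ★★`iter_blockAvg_comp_projBond`; §4 (T³, `F : T3Family`) `fieldShift_comp_projBond`, ★★★`descendTo_cover`,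
`comp_projBond_injective`, ★★`mem_fibre_cover_iff`, `regThreshold_cover`, `divSmall_cover_iff`, ★★`regPr_cover_iff`, `plaqSmall_cover_iff`, ★★`mem_regFibrePr_cover_iff`,
`wilsonAction4_cover`; §5 ★`isMinOn_cover_of_isMinOn` and the `famX` readings `famX_inU∕reg7∕inB_cover_iff`.  HONEST SCOPE: bookkeeping only; no analysis.

References: T. Bałaban, CMP **102** (1985) 277–309 [Balaban1985Variational] ((2)–(7) p.278, Thm 1 p.279, (144) p.300); CMP **109** (1987) 249–301 [Balaban1987RG1]
((0.1)–(0.4) pp.251–253, (0.11) p.253); CMP **98** (1985) 17–51 [Balaban1985Averaging] ((5), (8)–(11) pp.18–19); CMP **95** (1984) 17–40 [Balaban1984PropagatorsI] ((1.7) p.18).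
-/

set_option autoImplicit false

noncomputable section

open scoped BigOperators Matrix.Norms.L2Operator

namespace Summit.QuantumFields.YangMills.Theorems.SmallMembersCoverLift

open Literature.MathematicalPhysics.QuantumFieldTheory.Balaban1983to89
open T4Continuum AveragingRT BlockAveraging
open B10Eq27TorusAxialLog (holT)
open B10Eq68TorusRegularity (plaqFT covDerivT covDivT)
open T3ContinuumYM3Torus (T3Family)
open CoverSites

variable (P : Params) (jc : ℕ)

/-! ## §1 The covering map is a homomorphism of the lattice graph: transports, plaquettes, covariant divergence -/

section Graph

variable {G : Type*} [Group G] {j : ℕ}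

/-- **TRANSPORT ALONG A WORD COMMUTES WITH THE LIFT** (`B10Eq27TorusAxialLog.holT` spelling): `(V ∘ π)(Γ_{x̃,w}) = V(Γ_{π x̃, w})`. [cite: Balaban1985Averaging, (9) p.18] -/
theorem holT_comp_projBond (V : GaugeField P j G) :
    ∀ (w : List (Letter P.d)) (x : Site (cover P jc) j), holT (V ∘ projBond P jc j) x w = holT V (proj P jc j x) w
  | [], x => by simp [B10Eq27TorusAxialLog.holT]
  | (μ, true) :: w, x => by
    rw [B10Eq27TorusAxialLog.holT_cons_true, B10Eq27TorusAxialLog.holT_cons_true, holT_comp_projBond V w, proj_shift]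
    rfl
  | (μ, false) :: w, x => by
    rw [B10Eq27TorusAxialLog.holT_cons_false, B10Eq27TorusAxialLog.holT_cons_false, holT_comp_projBond V w, proj_unshift]
    simp only [Function.comp_apply, projBond, proj_unshift]

end Graph

section GraphGG

variable {G : Type*} [GaugeGroup G] {j : ℕ}

/-- **TRANSPORT ALONG A WALK COMMUTES WITH THE LIFT** (`T4Continuum.holAt ∘ walk` spelling of the (0.4) loop variables). [cite: Balaban1985Averaging, (9) p.18] -/
theorem holAt_walk_comp_projBond (U : GaugeField P j G) :
    ∀ (w : List (Letter P.d)) (x : Site (cover P jc) j), holAt (U ∘ projBond P jc j) (walk x w) = holAt U (walk (proj P jc j x) w)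
  | [], x => by simp [walk, holAt]
  | (μ, true) :: w, x => by
    have ih := holAt_walk_comp_projBond U w (x.shift μ)
    simp only [walk, holAt, List.map_cons, List.prod_cons, Function.comp_apply, ite_true] at ih ⊢
    rw [ih, proj_shift]; rfl
  | (μ, false) :: w, x => by
    have ih := holAt_walk_comp_projBond U w (x.unshift μ)
    simp only [walk, holAt, List.map_cons, List.prod_cons, Function.comp_apply] at ih ⊢
    rw [ih, proj_unshift]
    simp [projBond, proj_unshift]

/-- the end of a walk projects to the end of the projected walk. [folklore] -/
theorem proj_walkEnd : ∀ (w : List (Letter P.d)) (x : Site (cover P jc) j), proj P jc j (walkEnd x w) = walkEnd (proj P jc j x) w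
  | [], x => rfl
  | (μ, true) :: w, x => by rw [walkEnd, walkEnd, proj_walkEnd w, proj_shift]
  | (μ, false) :: w, x => by rw [walkEnd, walkEnd, proj_walkEnd w, proj_unshift]

/-- ★ **PLAQUETTE HOLONOMIES OF THE LIFT ARE THE HOLONOMIES OF THE PROJECTED PLAQUETTES**. [cite: Balaban1985Averaging, (9) p.19] -/
theorem plaqHol_comp_projBond (U : GaugeField P j G) (p : Plaq (cover P jc) j) :
    GaugeField.plaqHol (U ∘ projBond P jc j) p = GaugeField.plaqHol U (projPlaq P jc j p) := by
  simp only [GaugeField.plaqHol, Function.comp_apply, projBond, projPlaq, proj_shift]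

/-- `PlaqSmall` lifts and descends. [cite: Balaban1987RG1, (0.18) p.255] -/
theorem plaqSmall_comp_projBond_iff (δ : ℝ) (U : GaugeField P j G) : PlaqSmall δ (U ∘ projBond P jc j) ↔ PlaqSmall δ U := by
  refine ⟨fun h p => ?_, fun h p => by rw [plaqHol_comp_projBond]; exact h _⟩
  obtain ⟨x, hx⟩ := proj_surjective P jc j p.src
  have := h ⟨x, p.μ, p.ν, p.hμν⟩
  rwa [plaqHol_comp_projBond, projPlaq, hx] at this

end GraphGG

section Units

variable {𝔸 : Type*} [NormedRing 𝔸] [NormedAlgebra ℂ 𝔸] {j : ℕ}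

omit [NormedAlgebra ℂ 𝔸] in
/-- plaquette fields of the lift. [cite: Balaban1985RegularSpaces, (1.2) p.76] -/
theorem plaqFT_comp_projBond (V : GaugeField P j 𝔸ˣ) (μ ν : Fin P.d) (x : Site (cover P jc) j) :
    plaqFT (V ∘ projBond P jc j) μ ν x = plaqFT V μ ν (proj P jc j x) := by
  unfold B10Eq68TorusRegularity.plaqFT
  rw [holT_comp_projBond]

/-- the backward covariant derivative of a lifted site function along the lifted field. [cite: Balaban1985RegularSpaces, (1.1) p.76] -/
theorem covDerivT_comp_proj (η : ℝ) (V : GaugeField P j 𝔸ˣ) (ν : Fin P.d) (f : Site P j → 𝔸) (x : Site (cover P jc) j) :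
    covDerivT η (V ∘ projBond P jc j) ν (f ∘ proj P jc j) x = covDerivT η V ν f (proj P jc j x) := by
  unfold B10Eq68TorusRegularity.covDerivT
  simp only [Function.comp_apply, projBond, proj_unshift]

/-- ★ **THE COVARIANT DIVERGENCE OF THE LIFT IS THE LIFT OF THE COVARIANT DIVERGENCE** (clause 2 of (2) is local). [cite: Balaban1985RegularSpaces, (1.2) p.76] -/
theorem covDivT_comp_proj (η : ℝ) (V : GaugeField P j 𝔸ˣ) (μ : Fin P.d) (x : Site (cover P jc) j) :
    covDivT η (V ∘ projBond P jc j) μ x = covDivT η V μ (proj P jc j x) := by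
  unfold B10Eq68TorusRegularity.covDivT
  have h : ∀ κ κ' : Fin P.d, plaqFT (V ∘ projBond P jc j) κ κ' = plaqFT V κ κ' ∘ proj P jc j := fun κ κ' => by
    funext y; exact plaqFT_comp_projBond P jc V κ κ' y
  simp only [h, covDerivT_comp_proj]

end Units

/-! ## §2 The Wilson action of the lift -/

section Action

variable {G : Type*} [GaugeGroup G] {j : ℕ}

/-- **PLAQUETTE FIBRES**: every plaquette of `T^{(j)}` has exactly `(L^{jc})^d` lifts (`j ≤ m + K`; the fibre is the site fibre of the source). [folklore] -/
theorem card_fibre_plaq [DecidableEq (Plaq P j)] (hj : j ≤ P.m + P.K) (p : Plaq P j) :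
    (Finset.univ.filter fun pt : Plaq (cover P jc) j => projPlaq P jc j pt = p).card = (P.L ^ jc) ^ P.d := by
  let e : {pt : Plaq (cover P jc) j // projPlaq P jc j pt = p} ≃ {xt : Site (cover P jc) j // proj P jc j xt = p.src} :=
    { toFun := fun v => ⟨v.1.src, congrArg Plaq.src v.2⟩
      invFun := fun u => ⟨⟨u.1, p.μ, p.ν, p.hμν⟩, by rw [projPlaq, u.2]⟩
      left_inv := by
        rintro ⟨⟨xt, μ, ν, hμν⟩, hpt⟩
        have hμ : μ = p.μ := congrArg Plaq.μ hpt
        have hν : ν = p.ν := congrArg Plaq.ν hpt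
        subst hμ; subst hν
        rfl
      right_inv := fun _ => rfl }
  rw [← Fintype.card_subtype, Fintype.card_congr e, Fintype.card_subtype, card_fibre_site P jc j hj]

/-- ★★ **THE WILSON ACTION OF THE LIFT IS `(L^{jc})^d` TIMES THE ACTION** (regroup the plaquette sum over fibres). [cite: Balaban1987RG1, (0.2) p.252] -/
theorem wilsonAction_comp_projBond (hj : j ≤ P.m + P.K) (w : ℝ) (U : GaugeField P j G) :
    wilsonAction w (U ∘ projBond P jc j) = ((P.L : ℝ) ^ jc) ^ P.d * wilsonAction w U := by
  classical
  unfold wilsonAction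
  rw [Finset.mul_sum, ← Finset.sum_fiberwise_of_maps_to (s := Finset.univ) (t := Finset.univ) (g := projPlaq P jc j) (fun _ _ => Finset.mem_univ _)]
  refine Finset.sum_congr rfl fun p _ => ?_
  have hconst : ∀ pt ∈ Finset.univ.filter (fun pt : Plaq (cover P jc) j => projPlaq P jc j pt = p),
      w * (1 - reTr (GaugeField.plaqHol (U ∘ projBond P jc j) pt)) = w * (1 - reTr (GaugeField.plaqHol U p)) := by
    intro pt hpt
    rw [Finset.mem_filter] at hpt
    rw [plaqHol_comp_projBond, hpt.2]
  rw [Finset.sum_congr rfl hconst, Finset.sum_const, card_fibre_plaq P jc hj, nsmul_eq_mul]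
  push_cast; ring

/-- the unit-weight action of the lift. [cite: Balaban1987RG1, (0.2) p.252] -/
theorem wilsonAction4_comp_projBond (hj : j ≤ P.m + P.K) (U : GaugeField P j G) :
    wilsonAction4 (U ∘ projBond P jc j) = ((P.L : ℝ) ^ jc) ^ P.d * wilsonAction4 U :=
  wilsonAction_comp_projBond P jc hj 1 U

end Action

/-! ## §3 The (0.4) block average commutes with the lift -/

section Average

variable {G : Type*} [GaugeGroup G] {j : ℕ}

/-- the straight-line sites of a lifted coarse bond project to those of the projected bond (`j + 1 ≤ m + K`). [cite: Balaban1984PropagatorsI, (1.7) p.18] -/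
theorem proj_lineSite (hj : j + 1 ≤ P.m + P.K) (c : PBond (cover P jc) (j + 1)) (t : ℕ) :
    proj P jc j (lineSite c t) = lineSite (projBond P jc (j + 1) c) t := by
  have hemb : ∀ ν, proj P jc j (emb c.src) ν = emb (proj P jc (j + 1) c.src) ν := fun ν => congrFun (proj_emb P jc j hj c.src) ν
  funext ν
  show proj P jc j (Function.update (emb c.src) c.dir (emb c.src c.dir + t)) ν =
    Function.update (emb (proj P jc (j + 1) c.src)) c.dir (emb (proj P jc (j + 1) c.src) c.dir + t) ν
  by_cases h : ν = c.dir
  · subst h; rw [proj_apply, Function.update_self, Function.update_self, map_add, map_natCast, ← proj_apply, hemb]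
  · rw [proj_apply, Function.update_of_ne h, Function.update_of_ne h, ← proj_apply, hemb]

/-- partial transports along the straight line commute with the lift. [cite: Balaban1984PropagatorsI, (1.7) p.18] -/
theorem pathProd_comp_projBond (hj : j + 1 ≤ P.m + P.K) (U : GaugeField P j G) (c : PBond (cover P jc) (j + 1)) :
    ∀ n : ℕ, pathProd (U ∘ projBond P jc j) c n = pathProd U (projBond P jc (j + 1) c) n
  | 0 => rfl
  | n + 1 => by
    rw [pathProd, pathProd, pathProd_comp_projBond hj U c n]
    simp only [Function.comp_apply, AveragingRT.line, projBond, proj_lineSite P jc hj]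

/-- **THE AXIAL AVERAGE COMMUTES WITH THE LIFT**. [cite: Balaban1984PropagatorsI, (1.7) p.18] -/
theorem axialAvg_comp_projBond (hj : j + 1 ≤ P.m + P.K) (U : GaugeField P j G) :
    axialAvg (U ∘ projBond P jc j) = axialAvg U ∘ projBond P jc (j + 1) := by
  funext c
  exact pathProd_comp_projBond P jc hj U c P.L

/-- **THE (0.4) LOOP VARIABLES OF THE LIFT** are those of the projected coarse bond (same index family `Idx`: same `d`, `L`). [cite: Balaban1987RG1, (0.4) p.253] -/
theorem loopHol_comp_projBond (hj : j + 1 ≤ P.m + P.K) (U : GaugeField P j G) (c : PBond (cover P jc) (j + 1)) (i : Idx P) :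
    loopHol (U ∘ projBond P jc j) c i = loopHol U (projBond P jc (j + 1) c) i := by
  unfold BlockAveraging.loopHol
  rw [holAt_walk_comp_projBond, proj_emb P jc j hj]
  rfl

variable (ℰ : LoopAverage G)

/-- the small-field guard of (0.4) lifts and descends bondwise. [cite: Balaban1987RG1, (0.4) p.253] -/
theorem small_comp_projBond_iff (hj : j + 1 ≤ P.m + P.K) (U : GaugeField P j G) (c : PBond (cover P jc) (j + 1)) :
    Small ℰ (U ∘ projBond P jc j) c ↔ Small ℰ U (projBond P jc (j + 1) c) := by
  simp only [BlockAveraging.Small, loopHol_comp_projBond P jc hj]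

/-- the correction factor of (0.4) commutes with the lift. [cite: Balaban1987RG1, (0.4) p.253] -/
theorem corr_comp_projBond (hj : j + 1 ≤ P.m + P.K) (U : GaugeField P j G) (c : PBond (cover P jc) (j + 1)) :
    corr ℰ (U ∘ projBond P jc j) c = corr ℰ U (projBond P jc (j + 1) c) := by
  classical
  unfold BlockAveraging.corr
  have hl : loopHol (U ∘ projBond P jc j) c = loopHol U (projBond P jc (j + 1) c) := funext fun i => loopHol_comp_projBond P jc hj U c i
  simp only [small_comp_projBond_iff P jc ℰ hj, hl]

/-- ★★ **BAŁABAN'S (0.4) BLOCK AVERAGE COMMUTES WITH THE LIFT**: `M(U ∘ π) = M(U) ∘ π`. [cite: Balaban1987RG1, (0.4) p.253] -/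
theorem avgFun_comp_projBond (hj : j + 1 ≤ P.m + P.K) (U : GaugeField P j G) :
    avgFun ℰ (U ∘ projBond P jc j) = avgFun ℰ U ∘ projBond P jc (j + 1) := by
  funext c
  simp only [BlockAveraging.avgFun, Function.comp_apply, corr_comp_projBond P jc ℰ hj, axialAvg_comp_projBond P jc hj]

/-- ★★ **THE ITERATED (0.4) AVERAGE COMMUTES WITH THE LIFT**: `M^{k}(U ∘ π) = M^{k}(U) ∘ π` for `k ≤ m + K`. [cite: Balaban1987RG1, (0.11) p.253] -/
theorem iter_blockAvg_comp_projBond (U : GaugeField P 0 G) :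
    ∀ k : ℕ, k ≤ P.m + P.K →
      Averaging.iter (fun i => blockAvg (P := cover P jc) (j := i) ℰ) k (U ∘ projBond P jc 0) =
        Averaging.iter (fun i => blockAvg (P := P) (j := i) ℰ) k U ∘ projBond P jc k
  | 0, _ => rfl
  | k + 1, hk => by
    show (blockAvg ℰ).avg (Averaging.iter (fun i => blockAvg (P := cover P jc) (j := i) ℰ) k (U ∘ projBond P jc 0)) =
      (blockAvg ℰ).avg (Averaging.iter (fun i => blockAvg (P := P) (j := i) ℰ) k U) ∘ projBond P jc (k + 1)
    rw [iter_blockAvg_comp_projBond U k (by omega), blockAvg_avg, blockAvg_avg, avgFun_comp_projBond P jc ℰ hk]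

end Average

/-! ## §4 The T³ reading: descent, fibre, `RegPr`, `regFibrePr` lift AND descend between a member and its cover -/

section T3

open T3PrintedRegularMinimiser (RegPr DivSmall regFibrePr)
open T3RegularMinimiser (regThreshold regFibre)
open T3ConstrainedMinimiser (fibre)
open T3TiltDescent (descendTo)
open T3UnitLawDensityEML (ℰp)
open B10Eq27TorusAxialLog (unitsField toUField)

variable (F : T3Family)

/-- **THE LEVEL IDENTIFICATION COMMUTES WITH THE LIFT**: reading a height-`j′` field of the `K′`-th tower as a height-`j` field of the `K`-th tower
(`T3LevelShift.fieldShift`, a coordinatewise cast along equal moduli) and pulling back along the covering maps — in either order — agree, for the member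
`F` and its cover `F.cover jc` (both maps are `ZMod.val`-preserving∕reducing on the same canonical representatives). [cite: Balaban1987RG1, (0.1) p.251] -/
theorem fieldShift_comp_projBond {G : Type*} {K j K' j' : ℕ}
    (h : (F.PP F.m K).sitesPerDir j = (F.PP F.m K').sitesPerDir j')
    (h' : ((F.cover jc).PP (F.m + jc) K).sitesPerDir j = ((F.cover jc).PP (F.m + jc) K').sitesPerDir j')
    (W : GaugeField (F.P K') j' G) :
    T3LevelShift.fieldShift h' (W ∘ projBond (F.P K') jc j') = T3LevelShift.fieldShift h W ∘ projBond (F.P K) jc j := by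
  funext b
  show W (projBond (F.P K') jc j' (T3LevelShift.bondShift h' b)) = W (T3LevelShift.bondShift h (projBond (F.P K) jc j b))
  congr 1
  -- the two bonds of `(F.P K′, j′)` have the same direction and the same source
  have hsrc : proj (F.P K') jc j' (T3LevelShift.siteShift h' b.src) = T3LevelShift.siteShift h (proj (F.P K) jc j b.src) := by
    funext ν
    apply ZMod.val_injective
    have e1 : (proj (F.P K') jc j' (T3LevelShift.siteShift h' b.src) ν).val = (b.src ν).val % (F.P K').sitesPerDir j' := by
      rw [val_proj]
      exact congrArg (fun v : ℕ => v % (F.P K').sitesPerDir j') (T3LevelShift.coordEquiv_val h' (b.src ν))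
    have e2 : (T3LevelShift.siteShift h (proj (F.P K) jc j b.src) ν).val = (b.src ν).val % (F.P K).sitesPerDir j :=
      (T3LevelShift.coordEquiv_val h (proj (F.P K) jc j b.src ν)).trans (val_proj (F.P K) jc j b.src ν)
    -- the moduli agree: `(F.P K′).sitesPerDir j′ = (F.P K).sitesPerDir j`
    exact e1.trans ((congrArg (fun N : ℕ => (b.src ν).val % N) h.symm).trans e2.symm)
  show (⟨proj (F.P K') jc j' (T3LevelShift.siteShift h' b.src), b.dir⟩ : PBond (F.P K') j') = ⟨T3LevelShift.siteShift h (proj (F.P K) jc j b.src), b.dir⟩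
  rw [hsrc]

/-- ★★★ **THE DESCENT `D_{n,K}` COMMUTES WITH THE LIFT**: `D_{n,K}(U ∘ π_K) = D_{n,K}(U) ∘ π_n` — the (0.4) average is local and natural under the covering map
(§3), and so is the level identification. [cite: Balaban1987RG1, (0.11) p.253; Balaban1985UV3, (41) p.266] -/
theorem descendTo_cover {G : Type*} [GaugeGroup G] (ℰ : LoopAverage G) {n K : ℕ} (h : n ≤ K) (U : GaugeField (F.P K) 0 G) :
    descendTo (F.cover jc) ℰ n K h (U ∘ projBond (F.P K) jc 0) = descendTo F ℰ n K h U ∘ projBond (F.P n) jc 0 := by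
  unfold T3TiltDescent.descendTo
  have hk : K - n ≤ (F.P K).m + (F.P K).K := by show K - n ≤ F.m + K; omega
  rw [show Averaging.iter (fun i => blockAvg (P := (F.cover jc).P K) (j := i) ℰ) (K - n) (U ∘ projBond (F.P K) jc 0) =
      Averaging.iter (fun i => blockAvg (P := F.P K) (j := i) ℰ) (K - n) U ∘ projBond (F.P K) jc (K - n) from
    iter_blockAvg_comp_projBond (F.P K) jc ℰ U (K - n) hk]
  exact fieldShift_comp_projBond jc F _ _ _

/-- pulling back along the (surjective) covering map of bonds is injective on configurations. [folklore] -/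
theorem comp_projBond_injective {G : Type*} (K j : ℕ) :
    Function.Injective fun V : GaugeField (F.P K) j G => V ∘ projBond (F.P K) jc j :=
  (projBond_surjective (F.P K) jc j).injective_comp_right

/-- ★★ **THE FIBRE LIFTS AND DESCENDS**: `U ∘ π ∈ 𝔅_k(V ∘ π) ↔ U ∈ 𝔅_k(V)` (`InB` of the stub at the cover member ↔ at the member). [cite: Balaban1985Variational, (3) p.278] -/
theorem mem_fibre_cover_iff {G : Type*} [GaugeGroup G] (ℰ : LoopAverage G) {n K : ℕ} (h : n ≤ K) (V : GaugeField (F.P n) 0 G)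
    (U : GaugeField (F.P K) 0 G) :
    U ∘ projBond (F.P K) jc 0 ∈ fibre (F.cover jc) ℰ n K h (V ∘ projBond (F.P n) jc 0) ↔ U ∈ fibre F ℰ n K h V := by
  show descendTo (F.cover jc) ℰ n K h (U ∘ projBond (F.P K) jc 0) = V ∘ projBond (F.P n) jc 0 ↔ descendTo F ℰ n K h U = V
  rw [descendTo_cover]
  exact (comp_projBond_injective jc F n 0).eq_iff

variable {n K : ℕ}

/-- the plaquette threshold of print's regular space does not see the volume: same `L`, same `K − n`. [cite: Balaban1985Variational, (2) p.278] -/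
theorem regThreshold_cover (ε₀ : ℝ) : regThreshold (F.cover jc) n K ε₀ = regThreshold F n K ε₀ := rfl

/-- the `U(2)`-units reading of a lifted `SU(2)` field is the lift of the reading. [folklore] -/
theorem unitsField_toUField_comp_projBond (U : GaugeField (F.P K) 0 (Matrix.specialUnitaryGroup (Fin 2) ℂ)) :
    unitsField (toUField (U ∘ projBond (F.P K) jc 0)) = unitsField (toUField U) ∘ projBond (F.P K) jc 0 := rfl

/-- **THE DIVERGENCE CLAUSE OF (2) LIFTS AND DESCENDS**. [cite: Balaban1985Variational, (2) p.278; Balaban1985RegularSpaces, (1.9) p.77] -/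
theorem divSmall_cover_iff (ε₀ : ℝ) (U : GaugeField (F.P K) 0 (Matrix.specialUnitaryGroup (Fin 2) ℂ)) :
    DivSmall (F.cover jc) n K ε₀ (U ∘ projBond (F.P K) jc 0) ↔ DivSmall F n K ε₀ U := by
  unfold T3PrintedRegularMinimiser.DivSmall
  have key : ∀ bt : PBond ((F.cover jc).P K) 0,
      covDivT 1 (unitsField (toUField (U ∘ projBond (F.P K) jc 0))) bt.dir bt.src =
        covDivT 1 (unitsField (toUField U)) bt.dir (proj (F.P K) jc 0 bt.src) :=
    fun bt => covDivT_comp_proj (F.P K) jc 1 (unitsField (toUField U)) bt.dir bt.src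
  refine ⟨fun hU b => ?_, fun hU bt => by erw [key bt]; exact hU (projBond (F.P K) jc 0 bt)⟩
  obtain ⟨bt, hbt⟩ := projBond_surjective (F.P K) jc 0 b
  have := hU bt
  erw [key bt] at this
  rwa [← hbt]

/-- ★★ **PRINT'S REGULAR SPACE (2) LIFTS AND DESCENDS**: `U ∘ π ∈ 𝔘_k(ε₀)` on the cover `↔ U ∈ 𝔘_k(ε₀)` on the member (`InU` of the stub). [cite: Balaban1985Variational, (2) p.278] -/
theorem regPr_cover_iff (ε₀ : ℝ) (U : GaugeField (F.P K) 0 (Matrix.specialUnitaryGroup (Fin 2) ℂ)) :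
    RegPr (F.cover jc) n K ε₀ (U ∘ projBond (F.P K) jc 0) ↔ RegPr F n K ε₀ U := by
  unfold T3PrintedRegularMinimiser.RegPr
  rw [regThreshold_cover, divSmall_cover_iff]
  exact and_congr_left fun _ => plaqSmall_comp_projBond_iff (F.P K) jc _ U

/-- `PlaqSmall` of the comparison datum lifts and descends (`Reg7` of the stub). [cite: Balaban1985Variational, (7) p.278] -/
theorem plaqSmall_cover_iff (ε : ℝ) (V : GaugeField (F.P n) 0 (Matrix.specialUnitaryGroup (Fin 2) ℂ)) :
    PlaqSmall ε (V ∘ projBond (F.P n) jc 0) ↔ PlaqSmall ε V :=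
  plaqSmall_comp_projBond_iff (F.P n) jc ε V

/-- ★★ **PRINT'S SPACE (6) `𝔘_k(ε₀) ∩ 𝔅_k(V)` LIFTS AND DESCENDS**. [cite: Balaban1985Variational, (6) p.278] -/
theorem mem_regFibrePr_cover_iff (h : n ≤ K) (ε₀ : ℝ) (V : GaugeField (F.P n) 0 (Matrix.specialUnitaryGroup (Fin 2) ℂ))
    (U : GaugeField (F.P K) 0 (Matrix.specialUnitaryGroup (Fin 2) ℂ)) :
    U ∘ projBond (F.P K) jc 0 ∈ regFibrePr (F.cover jc) n K h ε₀ (V ∘ projBond (F.P n) jc 0) ↔ U ∈ regFibrePr F n K h ε₀ V := by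
  exact (T3PrintedRegularMinimiser.mem_regFibrePr_iff (F.cover jc)).trans
    (((mem_fibre_cover_iff jc F ℰp h V U).and (regPr_cover_iff jc F ε₀ U)).trans (T3PrintedRegularMinimiser.mem_regFibrePr_iff F).symm)

/-- **THE ACTION OF THE LIFTED MEMBER FIELD**: `A(U ∘ π) = (L^{jc})³·A(U)`. [cite: Balaban1987RG1, (0.2) p.252] -/
theorem wilsonAction4_cover {G : Type*} [GaugeGroup G] (U : GaugeField (F.P K) 0 G) :
    wilsonAction4 (U ∘ projBond (F.P K) jc 0) = ((F.L : ℝ) ^ jc) ^ 3 * wilsonAction4 U :=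
  wilsonAction4_comp_projBond (F.P K) jc (j := 0) (Nat.zero_le _) U

/-! ## §5 What DOES lift of the carrier's `IsCritical`: minimality among the lifted (= deck-invariant) competitors -/

/-- ★ **MINIMALITY LIFTS AMONG DECK-INVARIANT COMPETITORS**: if `U` minimises the Wilson action over print's space (6) at the member, then its lift minimises the
cover's action over the LIFTS of that space — the part of the carrier's `IsCritical` (`T3Thm1Carrier`, reading R2) that survives the covering; minimality over the
cover's FULL regular fibre does NOT follow (non-deck-invariant competitors), see FILE 2 for the first-order transfer. [cite: Balaban1985Variational, Thm 1 (8) p.279] -/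
theorem isMinOn_cover_of_isMinOn (h : n ≤ K) (ε₀ : ℝ) (V : GaugeField (F.P n) 0 (Matrix.specialUnitaryGroup (Fin 2) ℂ))
    {U : GaugeField (F.P K) 0 (Matrix.specialUnitaryGroup (Fin 2) ℂ)}
    (hmin : IsMinOn (fun W : GaugeField (F.P K) 0 (Matrix.specialUnitaryGroup (Fin 2) ℂ) => wilsonAction4 W) (regFibrePr F n K h ε₀ V) U) :
    IsMinOn (fun W : GaugeField ((F.cover jc).P K) 0 (Matrix.specialUnitaryGroup (Fin 2) ℂ) => wilsonAction4 W)
      (regFibrePr (F.cover jc) n K h ε₀ (V ∘ projBond (F.P n) jc 0) ∩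
        Set.range fun W : GaugeField (F.P K) 0 (Matrix.specialUnitaryGroup (Fin 2) ℂ) => W ∘ projBond (F.P K) jc 0)
      (U ∘ projBond (F.P K) jc 0) := by
  rintro _ ⟨hW, W, rfl⟩
  have hWmem : W ∈ regFibrePr F n K h ε₀ V := (mem_regFibrePr_cover_iff jc F h ε₀ V W).1 hW
  show wilsonAction4 (U ∘ projBond (F.P K) jc 0) ≤ wilsonAction4 (W ∘ projBond (F.P K) jc 0)
  rw [wilsonAction4_cover, wilsonAction4_cover]
  exact mul_le_mul_of_nonneg_left (hmin hWmem) (by positivity)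

open T3Thm1Carrier (famX Idx)

/-- `InU` of the stub lifts and descends along the cover. [cite: Balaban1985Variational, (2) p.278] -/
theorem famX_inU_cover_iff {L : ℕ} (i : Idx L) (ε₀ : ℝ) (U : (famX L i).Cfg) :
    (famX L ⟨(i.1.1.cover jc, i.1.2.1, i.1.2.2), ⟨i.2.1, i.2.2⟩⟩).InU ε₀ (U ∘ projBond (i.1.1.P i.1.2.2) jc 0) ↔ (famX L i).InU ε₀ U :=
  regPr_cover_iff jc i.1.1 ε₀ U

/-- `Reg7` of the stub lifts and descends along the cover. [cite: Balaban1985Variational, (7) p.278] -/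
theorem famX_reg7_cover_iff {L : ℕ} (i : Idx L) (ε₁ : ℝ) (V : (famX L i).Bdry) :
    (famX L ⟨(i.1.1.cover jc, i.1.2.1, i.1.2.2), ⟨i.2.1, i.2.2⟩⟩).Reg7 ε₁ (V ∘ projBond (i.1.1.P i.1.2.1) jc 0) ↔ (famX L i).Reg7 ε₁ V :=
  plaqSmall_cover_iff jc i.1.1 ε₁ V

/-- `InB` of the stub lifts and descends along the cover. [cite: Balaban1985Variational, (3) p.278] -/
theorem famX_inB_cover_iff {L : ℕ} (i : Idx L) (V : (famX L i).Bdry) (U : (famX L i).Cfg) :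
    (famX L ⟨(i.1.1.cover jc, i.1.2.1, i.1.2.2), ⟨i.2.1, i.2.2⟩⟩).InB (V ∘ projBond (i.1.1.P i.1.2.1) jc 0) (U ∘ projBond (i.1.1.P i.1.2.2) jc 0) ↔
      (famX L i).InB V U :=
  mem_fibre_cover_iff jc i.1.1 ℰp i.2.2.le V U

end T3

end Summit.QuantumFields.YangMills.Theorems.SmallMembersCoverLift

end
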